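import Literature.AlgebraicGeometry.HodgeTheory.HypersurfaceComplementCharts
import Literature.AlgebraicGeometry.HodgeTheory.LeviFormComposite
import HarnessLib

/-!
# The Morse functions `g_a` restricted along a holomorphic immersion: chart-level calculus
# (Voisin II, Prop. 1.19 for a complex submanifold of `ℂℙᴺ ∖ V(F)`)

Family `hodge`, layer `Literature/AlgebraicGeometry/HodgeTheory`.  A brick of the Morse-theoretic
(Andreotti–Frankel) input still missing for the named fact `BFNP2009_vanishingCohomology_nontrivial`
(Brosnan–Fang–Nie–Pearlstein 2009, Prop. 43), whose reduction
`BFNP2009_vanishingCohomology_nontrivial.of_andreottiFrankel_of_eulerChar`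
(`VanishingCohomologyNontrivialProofs`) needs `H_j((X ∖ Y)(ℂ); ℂ) = 0`, `j > dim X`, for the
complement of a hypersurface section `Y = X ∩ V₊(F)` of a smooth projective `X ↪ ℙᴺ`.  The tree
runs C. Voisin's programme (*Hodge Theory and Complex Algebraic Geometry II* (2003), §1.2.1–1.2.2,
Lemma 1.17, Prop. 1.19, Thm. 1.22) for `U_F = ℂℙᴺ ∖ V(F)` with the functions
`g_a = N_a/|F|²` (`HypersurfaceComplementCharts.lean`: chart expression `hC`, coordinate map `coordC`,
complex structure `Jop`; `HypersurfaceComplementMorse.lean`).  For `X ∖ Y ⊂ U_F` the Morse functions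
are the restrictions `g_a|_X`, whose chart expressions are `hC ∘ A_ℝ` for the realification `A_ℝ` of
the holomorphic immersion `A` = "affine coordinates of `X(ℂ) → ℙᴺ(ℂ)` in an algebraic chart"
(`EmbeddedVarietyImmersion.lean`).  This file is the chart-level calculus for an ABSTRACT holomorphic
map `A : ℂᵐ → ℂᴺ` (hypotheses at a point only) and an arbitrary real-linear identification
`L : ℂᵐ ≃ ℝ^{2m}` of the source (the tree's charts of `X(ℂ)` use `complexToEuclidean`):

* `realify L A = rc_N ∘ A ∘ L⁻¹ : ℝ^{2m} → ℝ^{2N}`, the complex structure `JL L = L ∘ (i·) ∘ L⁻¹`, and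
  `fderiv_realify_JL` — `D(A_ℝ)(J_L u) = Jop (D(A_ℝ) u)` (holomorphy in real coordinates);
  `injective_fderiv_realify` (immersions stay immersions);
* `hX = hC ∘ A_ℝ`, `coordX = coordC ∘ A_ℝ`, `hX_eq_inner` (`hX = ⟪a, coordX⟫`);
* `leviNum_denX_eq_zero`, `leviNum_numerX_pos` — the Levi numerators of `|F|² ∘ A_ℝ` (zero) and of
  `N_a ∘ A_ℝ` (positive in every direction `u ≠ 0` when `DA` is injective), by the invariance of
  `leviNum` under holomorphic maps (`LeviFormComposite.leviNum_comp_eq`);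
* `hessian_hX_add_pos`, `two_mul_sigNeg_hessian_hX_le` — **Voisin's Prop. 1.19 for the submanifold**:
  at a critical point of `hX` (all `a_p > 0`, `F ≠ 0` there, `d ≥ 1`, `DA` injective)
  `D²hX(u,u) + D²hX(J_L u, J_L u) > 0` for `u ≠ 0`, hence `2 · sigNeg (Hess hX) ≤ 2m`, i.e. Morse
  index `≤ m = dim_ℂ X`;
* `injective_fderiv_coordX` — `coordX` is an immersion (so that almost every `hX = ⟪a, coordX⟫` is a
  Morse function, Guillemin–Pollack Ch. 1 §7, used in the manifold-level file);
* `contDiffOn_hX`, `contDiffOn_coordX` — smoothness on the natural domain.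

Everything here is proved; the only definitions are the four abbreviations above; no named facts.

## References

* [VoisinHodgeII2003] C. Voisin, Hodge Theory and Complex Algebraic Geometry II (CUP 2003), §1.2.1
  Lemma 1.17 (PDF p. 57), Prop. 1.19 and Lemma 1.20 (PDF p. 58), §1.2.2 Thm. 1.22 (PDF p. 59).
* [Milnor1963] J. Milnor, Morse theory (1963), §6 Thm. 6.6, §7 Thm. 7.2.
-/

noncomputable section

open scoped Topology InnerProductSpace
open Filter Module Set Function

namespace Literature.AlgebraicGeometry.HodgeTheory

open Literature.Topology.FourManifolds Literature.Topology.FourManifolds.ComplexProjectiveSpace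
open HypersurfaceComplement

/-- Local notation: `𝔼 n` is the model Euclidean space `EuclideanSpace ℝ (Fin n)`. -/
local notation "𝔼 " n:arg => EuclideanSpace ℝ (Fin n)

/-! ### Realification of a holomorphic map along `L : ℂᵐ ≃ ℝ^{2m}` and `rc_N : ℂᴺ ≃ ℝ^{2N}` -/

section Realify

variable {m N : ℕ} (L : (Fin m → ℂ) ≃L[ℝ] 𝔼 (2 * m))

/-- **The realification `A_ℝ = rc_N ∘ A ∘ L⁻¹ : ℝ^{2m} → ℝ^{2N}`** of a map `A : ℂᵐ → ℂᴺ`, for a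
real-linear identification `L` of the source and the tree's `realCoordinates N` on the target.
[folklore] -/
def realify (A : (Fin m → ℂ) → (Fin N → ℂ)) : 𝔼 (2 * m) → 𝔼 (2 * N) :=
  fun y => realCoordinates N (A (L.symm y))

/-- Unfolding `realify`. [folklore] -/
theorem realify_apply (A : (Fin m → ℂ) → (Fin N → ℂ)) (y : 𝔼 (2 * m)) :
    realify L A y = realCoordinates N (A (L.symm y)) := rfl

/-- Multiplication by `c ∈ ℂ` on `ℂᵐ`, transported to `ℝ^{2m}` along `L`. [folklore] -/
def smulL (c : ℂ) : 𝔼 (2 * m) →L[ℝ] 𝔼 (2 * m) :=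
  (L : (Fin m → ℂ) →L[ℝ] 𝔼 (2 * m)).comp
    (((c • ContinuousLinearMap.id ℂ (Fin m → ℂ)).restrictScalars ℝ).comp
      (L.symm : 𝔼 (2 * m) →L[ℝ] (Fin m → ℂ)))

/-- `smulL L c u = L (c • L⁻¹ u)`. [folklore] -/
theorem smulL_apply (c : ℂ) (u : 𝔼 (2 * m)) : smulL L c u = L (c • L.symm u) := rfl

/-- **`J_L`: multiplication by `i` on `ℂᵐ` read in `ℝ^{2m}` through `L`**, a linear automorphism
(inverse: multiplication by `-i`). [folklore] -/
def JL : 𝔼 (2 * m) ≃L[ℝ] 𝔼 (2 * m) :=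
  ContinuousLinearEquiv.equivOfInverse (smulL L Complex.I) (smulL L (-Complex.I))
    (fun u => by simp [smulL_apply, smul_smul])
    (fun u => by simp [smulL_apply, smul_smul])

/-- `L⁻¹ (J_L u) = i · L⁻¹ u`. [folklore] -/
theorem symm_JL (u : 𝔼 (2 * m)) : L.symm (JL L u) = Complex.I • L.symm u := by
  change L.symm (smulL L Complex.I u) = _
  rw [smulL_apply, ContinuousLinearEquiv.symm_apply_apply]

/-- `J_L² = -1`. [folklore] -/
theorem JL_JL (u : 𝔼 (2 * m)) : JL L (JL L u) = -u := by
  apply L.symm.injective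
  rw [symm_JL, symm_JL, smul_smul, Complex.I_mul_I, neg_one_smul, map_neg]

/-- `Jop² = -1` for the tree's complex structure on `ℝ^{2N}`. [folklore] -/
theorem Jop_Jop (v : 𝔼 (2 * N)) : Jop N (Jop N v) = -v := by
  apply (realCoordinates N).symm.injective
  rw [realCoordinates_symm_Jop, realCoordinates_symm_Jop, smul_smul, Complex.I_mul_I, neg_one_smul,
    map_neg]

/-- `Jop (rc z) = rc (i · z)`. [folklore] -/
theorem Jop_realCoordinates (z : Fin N → ℂ) :
    Jop N (realCoordinates N z) = realCoordinates N (Complex.I • z) := by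
  apply (realCoordinates N).symm.injective
  rw [realCoordinates_symm_Jop, ContinuousLinearEquiv.symm_apply_apply,
    ContinuousLinearEquiv.symm_apply_apply]

variable {L} {A : (Fin m → ℂ) → (Fin N → ℂ)} {y : 𝔼 (2 * m)}

/-- **The derivative of the realification**: `D(A_ℝ)_y = rc_N ∘ D_ℂA_{L⁻¹ y} ∘ L⁻¹`. [folklore] -/
theorem hasFDerivAt_realify (hA : DifferentiableAt ℂ A (L.symm y)) :
    HasFDerivAt (realify L A) ((realCoordinates N : (Fin N → ℂ) →L[ℝ] 𝔼 (2 * N)).comp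
      (((fderiv ℂ A (L.symm y)).restrictScalars ℝ).comp (L.symm : 𝔼 (2 * m) →L[ℝ] (Fin m → ℂ)))) y :=
  (realCoordinates N).hasFDerivAt.comp y ((hA.hasFDerivAt.restrictScalars ℝ).comp y L.symm.hasFDerivAt)

/-- `D(A_ℝ)_y u = rc_N (D_ℂA (L⁻¹ u))`. [folklore] -/
theorem fderiv_realify_apply (hA : DifferentiableAt ℂ A (L.symm y)) (u : 𝔼 (2 * m)) :
    fderiv ℝ (realify L A) y u = realCoordinates N (fderiv ℂ A (L.symm y) (L.symm u)) := by
  rw [(hasFDerivAt_realify hA).fderiv]; rfl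

/-- **Holomorphy in real coordinates**: `D(A_ℝ)_y (J_L u) = Jop (D(A_ℝ)_y u)` (the complex derivative
is complex linear). [folklore] -/
theorem fderiv_realify_JL (hA : DifferentiableAt ℂ A (L.symm y)) (u : 𝔼 (2 * m)) :
    fderiv ℝ (realify L A) y (JL L u) = Jop N (fderiv ℝ (realify L A) y u) := by
  rw [fderiv_realify_apply hA, fderiv_realify_apply hA, symm_JL, map_smul, Jop_realCoordinates]

/-- Holomorphy in real coordinates, near a point. [folklore] -/
theorem eventually_fderiv_realify_JL (hA : ∀ᶠ w in 𝓝 (L.symm y), DifferentiableAt ℂ A w) :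
    ∀ᶠ y' in 𝓝 y, ∀ u, fderiv ℝ (realify L A) y' (JL L u) = Jop N (fderiv ℝ (realify L A) y' u) := by
  have h := (L.symm.continuous.tendsto y).eventually hA
  filter_upwards [h] with y' hy' u
  exact fderiv_realify_JL hy' u

/-- **Immersions stay immersions**: if `D_ℂA` is injective at `L⁻¹ y` then `D(A_ℝ)_y` is injective.
[folklore] -/
theorem injective_fderiv_realify (hA : DifferentiableAt ℂ A (L.symm y))
    (hinj : Injective (fderiv ℂ A (L.symm y))) : Injective (fderiv ℝ (realify L A) y) := by
  intro u v h
  rw [fderiv_realify_apply hA, fderiv_realify_apply hA] at h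
  exact L.symm.injective (hinj ((realCoordinates N).injective h))

/-- `A_ℝ` is `Cⁿ` at `y` if `A` is complex `Cⁿ` at `L⁻¹ y`. [folklore] -/
theorem contDiffAt_realify {n : WithTop ℕ∞} (hA : ContDiffAt ℂ n A (L.symm y)) :
    ContDiffAt ℝ n (realify L A) y :=
  (realCoordinates N).contDiff.contDiffAt.comp y
    ((hA.restrict_scalars ℝ).comp y L.symm.contDiff.contDiffAt)

/-- `A_ℝ` is `Cⁿ` on `L⁻¹⁻¹(s)` if `A` is complex `Cⁿ` on `s`. [folklore] -/
theorem contDiffOn_realify {n : WithTop ℕ∞} {s : Set (Fin m → ℂ)} (hA : ContDiffOn ℂ n A s) :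
    ContDiffOn ℝ n (realify L A) (L.symm ⁻¹' s) :=
  (realCoordinates N).contDiff.comp_contDiffOn
    ((hA.restrict_scalars ℝ).comp L.symm.contDiff.contDiffOn (mapsTo_preimage _ _))

end Realify

/-! ### The chart expressions `hX = hC ∘ A_ℝ`, `coordX = coordC ∘ A_ℝ` -/

namespace HypersurfaceSectionComplement

variable {m N : ℕ} (L : (Fin m → ℂ) ≃L[ℝ] 𝔼 (2 * m)) (A : (Fin m → ℂ) → (Fin N → ℂ))
  (i : Fin (N + 1)) (F : MvPolynomial (Fin (N + 1)) ℂ) (d : ℕ)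

/-- **The chart expression `hX = hC ∘ A_ℝ` of `g_a` restricted along `A`.** [cite: VoisinHodgeII2003, §1.2.2 Thm. 1.22 (PDF p. 59)] -/
def hX (a : EuclideanSpace ℝ (LIdx N)) (y : 𝔼 (2 * m)) : ℝ := hC i F d a (realify L A y)

/-- **The chart expression `coordX = coordC ∘ A_ℝ` of the coordinate functions restricted along `A`.**
[cite: VoisinHodgeII2003, §1.2.1 Lemma 1.17 (PDF p. 57)] -/
def coordX (y : 𝔼 (2 * m)) : EuclideanSpace ℝ (LIdx N) := coordC i F d (realify L A y)

/-- `hX = ⟪a, coordX⟫`: `hX` is the height function of `coordX` in the direction `a`. [folklore] -/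
theorem hX_eq_inner (a : EuclideanSpace ℝ (LIdx N)) (y : 𝔼 (2 * m)) :
    hX L A i F d a y = ⟪a, coordX L A i F d y⟫_ℝ :=
  hC_eq_inner i F d a _

/-- `{x | F(homV i x) ≠ 0}` is open. [folklore] -/
theorem isOpen_denV_ne : IsOpen {x : 𝔼 (2 * N) | denV F (homV i x) ≠ 0} :=
  isOpen_ne_fun (contDiff_denC i F (n := 0)).continuous continuous_const

/-- `hX` is smooth on `L(s) ∩ {F ∘ homV ∘ A_ℝ ≠ 0}` if `A` is complex smooth on `s`. [folklore] -/
theorem contDiffOn_hX (a : EuclideanSpace ℝ (LIdx N)) {n : WithTop ℕ∞} {s : Set (Fin m → ℂ)}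
    (hA : ContDiffOn ℂ n A s) :
    ContDiffOn ℝ n (hX L A i F d a) (L.symm ⁻¹' s ∩ {y | denV F (homV i (realify L A y)) ≠ 0}) :=
  (contDiffOn_hC i F d a).comp ((contDiffOn_realify hA).mono inter_subset_left) fun _ hy => hy.2

/-- `coordX` is smooth on `L(s) ∩ {F ∘ homV ∘ A_ℝ ≠ 0}` if `A` is complex smooth on `s`. [folklore] -/
theorem contDiffOn_coordX {n : WithTop ℕ∞} {s : Set (Fin m → ℂ)} (hA : ContDiffOn ℂ n A s) :
    ContDiffOn ℝ n (coordX L A i F d) (L.symm ⁻¹' s ∩ {y | denV F (homV i (realify L A y)) ≠ 0}) :=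
  (contDiffOn_coordC i F d).comp ((contDiffOn_realify hA).mono inter_subset_left) fun _ hy => hy.2

variable {L A} {y : 𝔼 (2 * m)}

/-- `hX` is smooth at `y` if `A` is complex smooth at `L⁻¹ y` and `F ≠ 0` there. [folklore] -/
theorem contDiffAt_hX (a : EuclideanSpace ℝ (LIdx N)) {n : WithTop ℕ∞} (hA : ContDiffAt ℂ n A (L.symm y))
    (hden : denV F (homV i (realify L A y)) ≠ 0) : ContDiffAt ℝ n (hX L A i F d a) y :=
  (contDiffAt_hC i F d a hden).comp y (contDiffAt_realify hA)

/-! ### The Levi numerators of `|F|² ∘ A_ℝ` and `N_a ∘ A_ℝ` -/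

/-- **`leviNum (|F|² ∘ A_ℝ) = 0`** (`log |F ∘ A|²` is pluriharmonic; invariance of `leviNum` under the
holomorphic `A` and `leviNum_denC_eq_zero`). [cite: VoisinHodgeII2003, §1.2.1 proof of Prop. 1.19 (PDF p. 58)] -/
theorem leviNum_denX_eq_zero (hA2 : ContDiffAt ℂ 2 A (L.symm y))
    (hAd : ∀ᶠ w in 𝓝 (L.symm y), DifferentiableAt ℂ A w) (u : 𝔼 (2 * m)) :
    leviNum (JL L : 𝔼 (2 * m) →L[ℝ] 𝔼 (2 * m)) (fun y' => denC i F (realify L A y')) y u = 0 :=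
  leviNum_comp_eq_zero (JL L : 𝔼 (2 * m) →L[ℝ] 𝔼 (2 * m)) (Jop N : 𝔼 (2 * N) →L[ℝ] 𝔼 (2 * N))
    (contDiffAt_realify hA2) (contDiff_denC i F).contDiffAt (eventually_fderiv_realify_JL hAd)
    Jop_Jop (leviNum_denC_eq_zero i F _ _)

/-- **`leviNum (N_a ∘ A_ℝ) > 0`** in every direction `u ≠ 0`, when all `a_p > 0` and `D_ℂA` is
injective at `L⁻¹ y` (invariance of `leviNum` under the holomorphic `A`, and `leviNum_numer_pos` in
the non-zero direction `D(A_ℝ) u`). [cite: VoisinHodgeII2003, §1.2.1 proof of Prop. 1.19 (PDF p. 58)] -/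
theorem leviNum_numerX_pos {a : EuclideanSpace ℝ (LIdx N)} (ha : ∀ p, 0 < a p)
    (hA2 : ContDiffAt ℂ 2 A (L.symm y)) (hAd : ∀ᶠ w in 𝓝 (L.symm y), DifferentiableAt ℂ A w)
    (hinj : Injective (fderiv ℂ A (L.symm y))) {u : 𝔼 (2 * m)} (hu : u ≠ 0) :
    0 < leviNum (JL L : 𝔼 (2 * m) →L[ℝ] 𝔼 (2 * m))
      (fun y' => numerV d a (homV i (realify L A y'))) y u := by
  have hN2 : ContDiffAt ℝ 2 (fun x : 𝔼 (2 * N) => numerV d a (homV i x)) (realify L A y) := by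
    rw [numerV_homV_eq i d a]
    exact ((contDiff_qC i a).mul ((contDiff_sC i).pow _)).contDiffAt
  have hv : fderiv ℝ (realify L A) y u ≠ 0 := by
    intro h
    exact hu (injective_fderiv_realify (hA2.differentiableAt (by simp)) hinj (by rw [h, map_zero]))
  exact leviNum_comp_pos (JL L : 𝔼 (2 * m) →L[ℝ] 𝔼 (2 * m)) (Jop N : 𝔼 (2 * N) →L[ℝ] 𝔼 (2 * N))
    (φ := fun x : 𝔼 (2 * N) => numerV d a (homV i x)) (contDiffAt_realify hA2) hN2
    (eventually_fderiv_realify_JL hAd) Jop_Jop (leviNum_numer_pos i ha _ hv)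

/-! ### Voisin II, Prop. 1.19 for the restriction: the index bound -/

/-- **`D²hX(u,u) + D²hX(J_L u, J_L u) > 0` at a critical point of `hX`** (all `a_p > 0`, `F ≠ 0` at
the point, `d ≥ 1`, `A` a holomorphic immersion at `L⁻¹ y`), for every `u ≠ 0`: since
`N_a ∘ A_ℝ = hX · (|F|² ∘ A_ℝ)` near `y` with `leviNum (|F|² ∘ A_ℝ) = 0` and `leviNum (N_a ∘ A_ℝ) > 0`
(`hessian_add_hessian_pos_of_isCriticalPt`). [cite: VoisinHodgeII2003, §1.2.1 Prop. 1.19, §1.2.2 Thm. 1.22 (PDF pp. 58–59)] -/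
theorem hessian_hX_add_pos (hd : 1 ≤ d) {a : EuclideanSpace ℝ (LIdx N)} (ha : ∀ p, 0 < a p)
    (hA2 : ContDiffAt ℂ 2 A (L.symm y)) (hAd : ∀ᶠ w in 𝓝 (L.symm y), DifferentiableAt ℂ A w)
    (hinj : Injective (fderiv ℂ A (L.symm y))) (hden : denV F (homV i (realify L A y)) ≠ 0)
    (hcrit : fderiv ℝ (hX L A i F d a) y = 0) {u : 𝔼 (2 * m)} (hu : u ≠ 0) :
    0 < fderiv ℝ (fun y' => fderiv ℝ (hX L A i F d a) y') y u u +
      fderiv ℝ (fun y' => fderiv ℝ (hX L A i F d a) y') y (JL L u) (JL L u) := by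
  have hPx : 0 < denC i F (realify L A y) :=
    lt_of_le_of_ne (by unfold denC denV; positivity) (Ne.symm hden)
  have hNx : 0 < numerV d a (homV i (realify L A y)) := numerV_pos hd ha (homV_ne_zero i _)
  have hhx : 0 < hX L A i F d a y := div_pos hNx hPx
  have hh : ContDiffAt ℝ 2 (hX L A i F d a) y := contDiffAt_hX i F d a hA2 hden
  have hP : ContDiffAt ℝ 2 (fun y' => denC i F (realify L A y')) y :=
    (contDiff_denC i F).contDiffAt.comp y (contDiffAt_realify hA2)
  have hne : ∀ᶠ y' in 𝓝 y, denC i F (realify L A y') ≠ 0 := hP.continuousAt.eventually_ne hden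
  have hN : (fun y' => numerV d a (homV i (realify L A y'))) =ᶠ[𝓝 y]
      fun y' => hX L A i F d a y' * denC i F (realify L A y') := by
    filter_upwards [hne] with y' hy'
    change numerV d a (homV i (realify L A y')) =
      numerV d a (homV i (realify L A y')) / denC i F (realify L A y') * denC i F (realify L A y')
    rw [div_mul_cancel₀ _ hy']
  exact hessian_add_hessian_pos_of_isCriticalPt _ hh hP hN hhx hPx hcrit u
    (leviNum_denX_eq_zero i F hA2 hAd u) (leviNum_numerX_pos i d ha hA2 hAd hinj hu)

/-- **The index bound for the restriction** (Voisin II, Prop. 1.19 with Lemma 1.20, on the complex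
submanifold): at a critical point of `hX` as above, the Hessian of `hX` has `2 · sigNeg ≤ 2m`, i.e.
Morse index `≤ m = dim_ℂ X`. [cite: VoisinHodgeII2003, §1.2.1 Prop. 1.19 and Lemma 1.20 (PDF p. 58)] -/
theorem two_mul_sigNeg_hessian_hX_le (hd : 1 ≤ d) {a : EuclideanSpace ℝ (LIdx N)} (ha : ∀ p, 0 < a p)
    (hA2 : ContDiffAt ℂ 2 A (L.symm y)) (hAd : ∀ᶠ w in 𝓝 (L.symm y), DifferentiableAt ℂ A w)
    (hinj : Injective (fderiv ℂ A (L.symm y))) (hden : denV F (homV i (realify L A y)) ≠ 0)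
    (hcrit : fderiv ℝ (hX L A i F d a) y = 0) :
    2 * sigNeg (LinearMap.BilinMap.toQuadraticMap ((ContinuousLinearMap.coeLM ℝ).comp
        (fderiv ℝ (fun y' => fderiv ℝ (hX L A i F d a) y') y).toLinearMap)) ≤ 2 * m := by
  have h := two_mul_sigNeg_hessian_le_finrank (JL L) (h := hX L A i F d a) (x := y)
    fun u hu => hessian_hX_add_pos i F d hd ha hA2 hAd hinj hden hcrit hu
  rwa [finrank_euclideanSpace_fin] at h

/-! ### The immersion property of `coordX` -/

/-- **`coordX = coordC ∘ A_ℝ` is an immersion** where `F ≠ 0` and `D_ℂA` is injective (composition of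
the immersions `coordC`, `injective_fderiv_coordC`, and `A_ℝ`). [cite: VoisinHodgeII2003, §1.2.1 Lemma 1.17 (PDF p. 57)] -/
theorem injective_fderiv_coordX (hA : DifferentiableAt ℂ A (L.symm y))
    (hinj : Injective (fderiv ℂ A (L.symm y))) (hden : denV F (homV i (realify L A y)) ≠ 0) :
    Injective (fderiv ℝ (coordX L A i F d) y) := by
  have h1 : DifferentiableAt ℝ (coordC i F d) (realify L A y) :=
    ((contDiffOn_coordC i F d (n := 1)).contDiffAt ((isOpen_denV_ne i F).mem_nhds hden)).differentiableAt
      (by simp)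
  have h2 : DifferentiableAt ℝ (realify L A) y := (hasFDerivAt_realify hA).differentiableAt
  rw [show coordX L A i F d = coordC i F d ∘ realify L A from rfl, fderiv_comp y h1 h2]
  exact (injective_fderiv_coordC i F d hden).comp (injective_fderiv_realify hA hinj)

end HypersurfaceSectionComplement

end Literature.AlgebraicGeometry.HodgeTheory
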